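import Summits.Langlands.Langlands.Theses.RetentionCarving
import Summits.Langlands.Langlands.Theorems.SoloBlindWDClass
import Literature.NumberTheory.GaloisRepresentations.WeilDeligneSemisimpleTraces
import Literature.NumberTheory.GaloisRepresentations.GenericWeilDeligneOrbitProofs

/-!
# `MonodromyFreeRigidity` (route RetentionCarving, support item stmt-Langlands-27962)

The U-locus local algebra of the lens-6 carving `RetentionCarving` (decomp-langlands, 2026-08-30):
a Frobenius-semisimple complex Weil–Deligne representation `W` of `W_F` on `ℂⁿ` with `W.N = 0` which
is GENERIC (no non-zero `q`-twisted intertwiner `f ∘ W.ρ w = q^{deg w} • W.ρ w ∘ f` commuting with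
`N`) is rigid among Frobenius-semisimple Weil–Deligne representations with the same traces: any such
`W'` has `W'.N = 0` and `W ≅ W'`.

Proof (the node's kernel-checked composition `MFR_birth.monodromyFreeRigidity_of`, with its two stubs
discharged by the tree): Brauer–Nesbitt for the semisimple Weil actions
(`WeilDeligneRep.nonempty_equiv_of_isFrobSemisimple_of_trace_eq`) gives `e : W.ρ ≅ W'.ρ`; transport
`W'` back to `W`'s space along `e⁻¹` (`SoloBlind.wd_exists_transport`) to get a Weil–Deligne
representation `r''` with `r''.ρ = W.ρ`; `r''` is generic a fortiori (its twisted self-intertwiners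
commuting with `r''.N` are in particular twisted self-intertwiners of `W.ρ` commuting with `W.N = 0`);
the generic-orbit theorem (`WeilDeligneRep.AHTW2026_prop_6_0_5_generic_conj_holds`,
[cite: AHTW2026, Prop. 6.0.5]) conjugates `W.N = 0` to `r''.N`, so `r''.N = 0`, hence `W'.N = 0`
and `e` is an isomorphism of Weil–Deligne representations.
-/

set_option linter.dupNamespace false -- project-wide option; `Summit.Langlands.Langlands` is the mandated namespace

namespace Summit.Langlands.Langlands.Theorems

open Literature.NumberTheory.GaloisRepresentations
open Literature.NumberTheory.GaloisRepresentations.IsNonarchimedeanLocalField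
open Literature.NumberTheory.GaloisRepresentations.WeilGroup

/-- The support item `stmt-Langlands-27962` of route RetentionCarving: **monodromy-free rigidity** —
a generic Frobenius-semisimple complex Weil–Deligne representation with `N = 0` is determined, among
Frobenius-semisimple Weil–Deligne representations, by its traces (and forces `N' = 0`).
Brauer–Nesbitt ∘ transport of structure ∘ the generic-orbit theorem [cite: AHTW2026, Prop. 6.0.5];
[cite: DeligneAntwerpII1973, §8.4.1]. -/
theorem MonodromyFreeRigidity_proof :
    Summit.Langlands.Langlands.Theses.RetentionCarving.MonodromyFreeRigidity := by
  intro F _ _ _ _ n W W' hW hW' htr h0 hgen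
  obtain ⟨e⟩ := WeilDeligneRep.nonempty_equiv_of_isFrobSemisimple_of_trace_eq hW hW' htr
  -- transport W' back to W's space along e⁻¹
  obtain ⟨r'', hρ'', hN''⟩ := SoloBlind.wd_exists_transport W' e.toLinearEquiv.symm
  have hW'ρ : ∀ w, W'.ρ w = e.toLinearEquiv.conjAlgEquiv ℂ (W.ρ w) := fun w => by
    have hint : (e.toLinearEquiv : (Fin n → ℂ) →ₗ[ℂ] (Fin n → ℂ)) ∘ₗ W.ρ w =
        W'.ρ w ∘ₗ (e.toLinearEquiv : (Fin n → ℂ) →ₗ[ℂ] (Fin n → ℂ)) := e.isIntertwining' w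
    rw [LinearEquiv.conjAlgEquiv_apply, ← LinearMap.comp_assoc, LinearEquiv.eq_comp_toLinearMap_symm]
    exact hint.symm
  have hρfun : ∀ w, r''.ρ w = W.ρ w := fun w => by
    rw [hρ'' w, hW'ρ w, LinearEquiv.conjAlgEquiv_apply, LinearEquiv.conjAlgEquiv_apply]
    refine LinearMap.ext fun x => ?_
    simp only [LinearMap.coe_comp, Function.comp_apply, LinearEquiv.coe_coe, LinearEquiv.symm_symm]
    change e.toLinearEquiv.symm (e.toLinearEquiv (W.ρ w (e.toLinearEquiv.symm (e.toLinearEquiv x)))) = W.ρ w x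
    rw [LinearEquiv.symm_apply_apply, LinearEquiv.symm_apply_apply]
  have hρeq : r''.ρ = W.ρ := MonoidHom.ext hρfun
  have hgen'' : ∀ f : (Fin n → ℂ) →ₗ[ℂ] (Fin n → ℂ),
      (∀ w : WeilGroup F, f ∘ₗ r''.ρ w = ((residueFieldCard F : ℂ) ^ (deg w)) • (r''.ρ w ∘ₗ f)) →
      f ∘ₗ r''.N = r''.N ∘ₗ f → f = 0 := by
    intro f hf _
    exact hgen f (fun w => by rw [← hρfun w]; exact hf w) (by rw [h0, LinearMap.comp_zero, LinearMap.zero_comp])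
  obtain ⟨g, -, hg⟩ := WeilDeligneRep.AHTW2026_prop_6_0_5_generic_conj_holds W r'' hρeq hW hgen hgen''
  rw [h0, LinearMap.comp_zero] at hg
  have hN''0 : r''.N = 0 := by
    have h : r''.N = (r''.N ∘ₗ (g : (Fin n → ℂ) →ₗ[ℂ] (Fin n → ℂ))) ∘ₗ
        (g.symm : (Fin n → ℂ) →ₗ[ℂ] (Fin n → ℂ)) := by
      rw [LinearMap.comp_assoc, LinearEquiv.comp_symm, LinearMap.comp_id]
    rw [h, ← hg, LinearMap.zero_comp]
  have hW'0 : W'.N = 0 := by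
    rw [hN''] at hN''0
    exact (map_eq_zero_iff _ (e.toLinearEquiv.symm.conjAlgEquiv ℂ).injective).mp hN''0
  refine ⟨hW'0, ⟨{ toRepEquiv := e, comm_N := ?_ }⟩⟩
  rw [h0, hW'0, LinearMap.comp_zero, LinearMap.zero_comp]

end Summit.Langlands.Langlands.Theorems
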